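import Summits.SmoothPoincare4.SmoothPoincare4.Theses.DissolvableGluck
import Summits.SmoothPoincare4.SmoothPoincare4.Theses.OneStabInvertible
import Literature.Topology.FourManifolds.GluckTwistHomotopySphereProofs
import HarnessLib
import HarnessLib.Audit

/-!
# Birth skeleton (BC3) for crux `DissolvableGluck.GluckTwistsStandard` (item stmt-SmoothPoincare4-17711)

Line `birth` — the SCHOENFLIES-BALL SPLIT of the Gluck twist conjecture (GLUCK), exactly the birth line
foreseen in the route header of `route-SmoothPoincare4-DissolvableGluck` (TWO-LAYER PLAN: "GluckTwistsStandard ⇐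
GluckInvertible (every Gluck twist is a connected summand of S⁴; GNS 2025 Q5.6) → InvertibleStandard (shared with
OneStabInvertible, stmt-SmoothPoincare4-18065)"), registered by the skeleton-registrar seat because the opening
planner's `crux write` was refused (its unit did not name the crux).

GLUCK (the crux, verbatim the route decl
`Summit.SmoothPoincare4.SmoothPoincare4.Theses.DissolvableGluck.GluckTwistsStandard`, = the registered open
conjecture `Literature.Topology.FourManifolds.GluckTwistConjecture.{0}` by `Iff.rfl`): for every smooth 2-knot
`K : S² ↪ S⁴` and every Hausdorff second-countable smooth 4-manifold `X` with `IsGluckTwist (𝓡 4) X K`,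
`X ≅ S⁴`.

The line factors GLUCK through the monoid of homotopy 4-spheres, using ONLY tree vocabulary
(`IsGluckTwist`, `TwoKnot`, `IsConnectedSum`) and one PROVED tree theorem (Gluck 1962 §17:
`IsGluckTwist.nonempty_homotopyEquiv_sphere`, file `GluckTwistHomotopySphereProofs`):

* STUB 1 `stub_gluckInvertible` — EVERY GLUCK TWIST IS A SCHOENFLIES BALL (Gabai–Naylor–Schwartz, Adv. Math. 480
  (2025) = arXiv:2307.06388, Question 5.6 verbatim: "Are all Gluck twists diffeomorphic to Schoenflies balls? In
  other words, does Σ_S° always smoothly embed in S⁴?"), in monoid form: for every Gluck twist `X` of `S⁴` along `K`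
  there is a closed smooth 4-manifold `M'` such that `S⁴` IS a connected sum `X # M'` (relational `IsConnectedSum`,
  all slots on `𝓡 4`) — `X` is a connected summand of `S⁴` (a unit of the Kervaire–Milnor monoid in dimension 4).
  OPEN. Proved sub-families in print (not in the tree): `Σ_S° × I ≅ B⁵` (so `M' = -Σ_S` works) when `S` is a union
  of two ribbon discs one of which has undisking number one (GNS 2025 Thm 1.1 / Thm 5.5, Cor. 5.1, 5.3), all
  twist-spun / ribbon / 0-concordant-to-ribbon cases (where `Σ_S ≅ S⁴` outright: Gluck 1962, Gordon 1976,
  Melvin 1977). It is NOT the crux: it produces an embedding `X° ↪ S⁴`, not a diffeomorphism `X ≅ S⁴`; passing from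
  one to the other is exactly the smooth Schoenflies problem (STUB 2), open since Mazur 1959 / Kirby 4.32.
* STUB 2 `stub_invertibleStandard` — INVERTIBLE HOMOTOPY 4-SPHERES ARE STANDARD (smooth 4-dimensional Schoenflies in
  monoid form, + Cerf `Γ₄ = 0`): for every smooth homotopy 4-sphere `M` (`e : M ≃ₕ S⁴`) and every closed smooth `M'`
  with `S⁴ = M # M'`, `M ≅ S⁴`. VERBATIM the body of the route item
  `Summit.SmoothPoincare4.SmoothPoincare4.Theses.OneStabInvertible.InvertibleStandard` (stmt-SmoothPoincare4-18065,
  crux SCH of route OneStabInvertible) — the identity is `Iff.rfl` (certified by an `example`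
  below), so this stub is SHARED with that item, not a new obligation. OPEN (Kirby 4.32; FreedmanGompfMorrisonWalker2010). It is NOT the crux and not the summit: it says
  nothing about Gluck twists, and reaches GLUCK only through STUB 1 (resp. the summit only through "every
  homotopy 4-sphere is invertible", OneStabInvertible's INV ∘ S1, open).

COMPOSITION (kernel-checked, no `sorry` outside the two stubs): `gluckTwistsStandard_of_stubs : <stub₁-sig> →
<stub₂-sig> → <the crux statement, unfolded>` (4 tactic lines: take `K, X, hX`; Gluck §17 (PROVED tree theorem
`IsGluckTwist.nonempty_homotopyEquiv_sphere`) gives `e : X ≃ₕ S⁴`; STUB 1 gives `M'` with `S⁴ = X # M'`; STUB 2 at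
`(X, e, M')` is the goal) and THE skeleton theorem
`GluckTwistsStandard_of : DissolvableGluck.GluckTwistsStandard := gluckTwistsStandard_of_stubs stub_gluckInvertible
stub_invertibleStandard` — the crux BY NAME, closed modulo the two registered stubs (D-0027 §3.3 shape). It is
deliberately the ONLY named theorem of the file whose conclusion is the crux constant, so `#h21_check_skeleton`
audits exactly it; the arrow form `<stub₁-sig> → <stub₂-sig> → GluckTwistsStandard` with the crux BY NAME is
certified by the closing `example`.

DISPROOF USED: no `Disproof.lean` exists for this crux (`ledger crux ls stmt-SmoothPoincare4-17711`: no workfiles,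
2026-08-17); `ledger negatives --problem SmoothPoincare4`: no entry for GluckTwistsStandard / InvertibleStandard.
Refuter evidence on the item (W2.lean, 2026-08-17): the crux survives triviality / vacuity / junk probes; its
hypothesis is inhabited (S⁴ = Σ_unknot, `isGluckTwist_sphere_unknotTwo_holds`; `exists_isGluckTwist_holds`), so
STUB 1 is not vacuous; STUB 2's hypotheses are inhabited by `M = M' = S⁴` (S⁴ # S⁴ = S⁴).

BARRIERS: `Literature.Barriers.SmoothPoincare4.GluckTwistCP2Barrier` (every Gluck twist dissolves in one ℂℙ²,
so ℂℙ²-stable invariants are blind) obstructs REFUTING either stub by stable invariants, not proving them;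
`HCobordismBarrierFour` — void: STUB 1's printed engine is the 5-dimensional PRODUCT statement `Σ° × I ≅ B⁵`
(relative handle cancellation in a 5-dimensional 2-handlebody), not an h-cobordism ⇒ diffeomorphism step;
`TwistedSphereBarrierFour` (Γ₄ = 0) is used consistently inside STUB 2 (capping the complementary ball);
`StableBarrierFour`, `OneStabilisationBarrier` — void (no S²×S² summand anywhere). SPC4-shielding bites, as for
the crux itself: both stubs are consequences of `SmoothPoincare4`, so a refutation of either is an exotic S⁴.
-/

noncomputable section

open scoped Manifold ContDiff Topology
open Literature.Topology.FourManifolds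

namespace Summit.SmoothPoincare4.SmoothPoincare4.Cruxes.GluckTwistsStandard.Birth

set_option linter.dupNamespace false
set_option linter.unusedVariables false

/-- Local notation: the round 4-sphere `S⁴ ⊂ ℝ⁵` (Mathlib manifold structure, model `𝓡 4`). -/
local notation "S⁴" => (Metric.sphere (0 : EuclideanSpace ℝ (Fin 5)) 1)

/-! ## The two registered stubs (`sorry` lives ONLY here; signatures spelled out over tree declarations) -/

/-- STUB 1 (registered) — EVERY GLUCK TWIST IS A SCHOENFLIES BALL, monoid form (GabaiNaylorSchwartz2025 =
arXiv:2307.06388, Question 5.6): for every 2-knot `K` and every Gluck twist `X` of `S⁴` along `K` (Hausdorff,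
second countable, `C^∞` on `𝓡 4`, `IsGluckTwist (𝓡 4) X K`) there is a closed smooth 4-manifold `M'` (same
binders) such that `S⁴` is a connected sum `X # M'` (`IsConnectedSum (𝓡 4) (𝓡 4) (𝓡 4) X M' S⁴`), i.e. the
punctured Gluck twist `X°` embeds smoothly in `S⁴`. Size: open problem (the hardest stub; known for 2-knots with a
ribbon hemisphere of undisking number one, GNS 2025 Thm 5.5, where even `X° × I ≅ B⁵`, Thm 1.1). -/
theorem stub_gluckInvertible :
    ∀ (K : TwoKnot) (X : Type) [TopologicalSpace X] [T2Space X] [SecondCountableTopology X]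
      [ChartedSpace (EuclideanSpace ℝ (Fin 4)) X] [IsManifold (𝓡 4) ∞ X],
      IsGluckTwist (𝓡 4) X K →
        ∃ (M' : Type) (_ : TopologicalSpace M') (_ : T2Space M') (_ : SecondCountableTopology M')
          (_ : ChartedSpace (EuclideanSpace ℝ (Fin 4)) M') (_ : IsManifold (𝓡 4) ∞ M'),
          IsConnectedSum (𝓡 4) (𝓡 4) (𝓡 4) X M' S⁴ := by
  sorry

/-- STUB 2 (registered) — INVERTIBLE HOMOTOPY 4-SPHERES ARE STANDARD (smooth Schoenflies, monoid form; Kirby 4.32,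
FreedmanGompfMorrisonWalker2010): for every smooth homotopy 4-sphere `M` (`e : M ≃ₕ S⁴`) and every closed smooth
`M'` with `S⁴ = M # M'` (`IsConnectedSum (𝓡 4) (𝓡 4) (𝓡 4) M M' S⁴`), `M ≅ S⁴`. VERBATIM the body of
`Summit.SmoothPoincare4.SmoothPoincare4.Theses.OneStabInvertible.InvertibleStandard` (item stmt-SmoothPoincare4-18065;
`Iff.rfl`, certified by the `example` right below). Size: open problem (shared obligation). -/
theorem stub_invertibleStandard :
    ∀ (M : Type) [TopologicalSpace M] [T2Space M] [SecondCountableTopology M]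
      [ChartedSpace (EuclideanSpace ℝ (Fin 4)) M] [IsManifold (𝓡 4) ∞ M],
      ContinuousMap.HomotopyEquiv M S⁴ →
        ∀ (M' : Type) [TopologicalSpace M'] [T2Space M'] [SecondCountableTopology M']
          [ChartedSpace (EuclideanSpace ℝ (Fin 4)) M'] [IsManifold (𝓡 4) ∞ M'],
          IsConnectedSum (𝓡 4) (𝓡 4) (𝓡 4) M M' S⁴ → Nonempty (M ≃ₘ⟮𝓡 4, 𝓡 4⟯ S⁴) := by
  sorry

/-! ## Bookkeeping (no `sorry`): STUB 2 is the OneStabInvertible item, by `Iff.rfl` -/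

/-- STUB 2's statement is, verbatim, the route item `OneStabInvertible.InvertibleStandard`
(stmt-SmoothPoincare4-18065): the two obligations are one (an `example`, so the tree audit sees no orphan
constant; cite it as "`Iff.rfl` with `OneStabInvertible.InvertibleStandard`"). -/
example :
    (∀ (M : Type) [TopologicalSpace M] [T2Space M] [SecondCountableTopology M]
      [ChartedSpace (EuclideanSpace ℝ (Fin 4)) M] [IsManifold (𝓡 4) ∞ M],
      ContinuousMap.HomotopyEquiv M S⁴ →
        ∀ (M' : Type) [TopologicalSpace M'] [T2Space M'] [SecondCountableTopology M']
          [ChartedSpace (EuclideanSpace ℝ (Fin 4)) M'] [IsManifold (𝓡 4) ∞ M'],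
          IsConnectedSum (𝓡 4) (𝓡 4) (𝓡 4) M M' S⁴ → Nonempty (M ≃ₘ⟮𝓡 4, 𝓡 4⟯ S⁴)) ↔
      Summit.SmoothPoincare4.SmoothPoincare4.Theses.OneStabInvertible.InvertibleStandard :=
  Iff.rfl

/-! ## Composition: stubs ⟹ crux (no `sorry` below this line) -/

/-- **The Schoenflies-ball split of GLUCK, arrow form**: if every Gluck twist is a connected summand of `S⁴`
(STUB 1) and every invertible homotopy 4-sphere is standard (STUB 2), then every Gluck twist is standard — the
statement of the crux `DissolvableGluck.GluckTwistsStandard`, unfolded (so that this arrow theorem is not itself a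
by-name candidate for the skeleton audit; the by-name theorem is `GluckTwistsStandard_of` below). The homotopy
equivalence `X ≃ₕ S⁴` that STUB 2 needs is Gluck 1962 §17, a PROVED tree theorem
(`IsGluckTwist.nonempty_homotopyEquiv_sphere`). -/
theorem gluckTwistsStandard_of_stubs
    (h₁ : ∀ (K : TwoKnot) (X : Type) [TopologicalSpace X] [T2Space X] [SecondCountableTopology X]
      [ChartedSpace (EuclideanSpace ℝ (Fin 4)) X] [IsManifold (𝓡 4) ∞ X],
      IsGluckTwist (𝓡 4) X K →
        ∃ (M' : Type) (_ : TopologicalSpace M') (_ : T2Space M') (_ : SecondCountableTopology M')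
          (_ : ChartedSpace (EuclideanSpace ℝ (Fin 4)) M') (_ : IsManifold (𝓡 4) ∞ M'),
          IsConnectedSum (𝓡 4) (𝓡 4) (𝓡 4) X M' S⁴)
    (h₂ : ∀ (M : Type) [TopologicalSpace M] [T2Space M] [SecondCountableTopology M]
      [ChartedSpace (EuclideanSpace ℝ (Fin 4)) M] [IsManifold (𝓡 4) ∞ M],
      ContinuousMap.HomotopyEquiv M S⁴ →
        ∀ (M' : Type) [TopologicalSpace M'] [T2Space M'] [SecondCountableTopology M']
          [ChartedSpace (EuclideanSpace ℝ (Fin 4)) M'] [IsManifold (𝓡 4) ∞ M'],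
          IsConnectedSum (𝓡 4) (𝓡 4) (𝓡 4) M M' S⁴ → Nonempty (M ≃ₘ⟮𝓡 4, 𝓡 4⟯ S⁴)) :
    ∀ (K : TwoKnot) (X : Type) [TopologicalSpace X] [T2Space X] [SecondCountableTopology X]
      [ChartedSpace (EuclideanSpace ℝ (Fin 4)) X] [IsManifold (𝓡 4) ∞ X],
      IsGluckTwist (𝓡 4) X K → Nonempty (X ≃ₘ⟮𝓡 4, 𝓡 4⟯ S⁴) := by
  intro K X _ _ _ _ _ hX
  obtain ⟨e⟩ := hX.nonempty_homotopyEquiv_sphere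
  obtain ⟨M', _, _, _, _, _, hcs⟩ := h₁ K X hX
  exact h₂ X e M' hcs

/-- **`GluckTwistsStandard_of` — THE SKELETON**: the crux `DissolvableGluck.GluckTwistsStandard` BY NAME, closed
modulo the two registered stubs (D-0027 §3.3: `<Crux>_of := crux_of_stubs stub₁ stub₂`). Becomes the crux proof
when both stubs are discharged. -/
theorem GluckTwistsStandard_of :
    Summit.SmoothPoincare4.SmoothPoincare4.Theses.DissolvableGluck.GluckTwistsStandard :=
  gluckTwistsStandard_of_stubs stub_gluckInvertible stub_invertibleStandard

/-- BC3 letter: `<stub₁-sig> → <stub₂-sig> → GluckTwistsStandard` with the crux BY NAME (an `example`, so that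
`GluckTwistsStandard_of` stays the only by-name candidate the skeleton audit sees). -/
example :
    (∀ (K : TwoKnot) (X : Type) [TopologicalSpace X] [T2Space X] [SecondCountableTopology X]
      [ChartedSpace (EuclideanSpace ℝ (Fin 4)) X] [IsManifold (𝓡 4) ∞ X],
      IsGluckTwist (𝓡 4) X K →
        ∃ (M' : Type) (_ : TopologicalSpace M') (_ : T2Space M') (_ : SecondCountableTopology M')
          (_ : ChartedSpace (EuclideanSpace ℝ (Fin 4)) M') (_ : IsManifold (𝓡 4) ∞ M'),
          IsConnectedSum (𝓡 4) (𝓡 4) (𝓡 4) X M' S⁴) →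
    (∀ (M : Type) [TopologicalSpace M] [T2Space M] [SecondCountableTopology M]
      [ChartedSpace (EuclideanSpace ℝ (Fin 4)) M] [IsManifold (𝓡 4) ∞ M],
      ContinuousMap.HomotopyEquiv M S⁴ →
        ∀ (M' : Type) [TopologicalSpace M'] [T2Space M'] [SecondCountableTopology M']
          [ChartedSpace (EuclideanSpace ℝ (Fin 4)) M'] [IsManifold (𝓡 4) ∞ M'],
          IsConnectedSum (𝓡 4) (𝓡 4) (𝓡 4) M M' S⁴ → Nonempty (M ≃ₘ⟮𝓡 4, 𝓡 4⟯ S⁴)) →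
    Summit.SmoothPoincare4.SmoothPoincare4.Theses.DissolvableGluck.GluckTwistsStandard :=
  gluckTwistsStandard_of_stubs

end Summit.SmoothPoincare4.SmoothPoincare4.Cruxes.GluckTwistsStandard.Birth
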